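import Summits.BirchSwinnertonDyer.BirchSwinnertonDyer.Theorems.KatoDescentPotSupersingularWildUpperReducibleNineTorsionLocal
import Summits.BirchSwinnertonDyer.Rank1Residual.Additive.QuadraticTwistBSDComparisonIsogeny
import Summits.BirchSwinnertonDyer.Rank1Residual.X2.IsogenyClassStability
import Literature.NumberTheory.EllipticCurves.GlobalMinimalModelProofs
import Literature.NumberTheory.EllipticCurves.BSDInvariantsProofs
import Literature.NumberTheory.EllipticCurves.ComplexMultiplicationBSDTripleProofs
import Literature.NumberTheory.EllipticCurves.ComplexMultiplicationLFunctionIsogenyHoldsProofs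
import Literature.NumberTheory.EllipticCurves.AnomalousOfRationalTorsionProofs
import Literature.NumberTheory.EllipticCurves.IsogenyIdProofs
import HarnessLib

/-!
# Route `KatoDescentPotSupersingular` (rung K9, cell `bsd-potss`), crux `WildUpperReducibleDefect` (item
# stmt-BirchSwinnertonDyer-19190), registered stub `stub_red_nineTorsionMember`: the STRUCTURE OF ITS SCOPE on the
# `ℚ`-isogeny class, UNCONDITIONALLY, and the stub REDUCED TO ITS `ℤ/9` CURVES (modulo Cassels / GZK / modularity).
# ROUTE-FREE (imports no `Theses.*` file); a `--supports 19190 --as helper` file (seat `bsd-potss-k9-red9` g5);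
# nothing booked, BSD is not proved by any of this

THE STUB (skeleton `K9_WildUpperReducibleDefect_birth.lean`, sha16 `cf5b536188b35c38`), verbatim:
`∀ W` globally minimal elliptic, `r_an(W) = 0 → ClassO6 W 3 → ¬ Irr W 3 → (∃ W' elliptic, W ∼ W' ∧ 3² ∣ #W'(ℚ)_tors) →
MissingUpperBoundAt W 3`. Class-wide it is Kato's sharp member count (held input 19707; p459279); its census scope
(C-X3K-0: classes 54b, 1890r, 122094bl) is in the kernel per class (p464900 … p475729, certificates j256899/j263658).

THIS FILE (all of §1 unconditional; §2 conditional only on the three named facts it displays) reads the sibling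
`…NineTorsionLocal` (one curve at an additive prime) on the CLASS, passing to a globally minimal model of `W'`
(`hasGlobalMinimalModel_rat_holds`, same torsion order: `torsionOrder_variableChange_holds`) and transporting additive
reduction along the isogeny (`X2.addv_iff_of_isIsogenous`, Serre–Tate / *AEC* VII.7.2):

* §1 **the scope, structurally.** On a row of the stub (`W` wild at `3`, `W ∼ W'`, `9 ∣ #W'(ℚ)_tors`):
  (a) `W'` carries a rational point of ORDER `9` (`nineTorsionMember_iff_exists_addOrderOf_eq_nine`: the hypothesis is
  «the class meets `X₁(9)`»); (b) **`W` — and every member — is SEMISTABLE AT EVERY PRIME `ℓ ≠ 3`**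
  (`not_addv_of_isIsogenous_of_nine_dvd_torsionOrder`; so `N_W = 3^{f₃} · m`, `m` squarefree, `3 ∤ m` — census
  `54 = 27·2`, `1890 = 27·70`, `122094 = 27·4522`); (c) **every member `W''` has `ord₃ #W''(ℚ)_tors ≤ 2`** and
  `#W''(ℚ)_tors ≤ 12`, Mazur-free (the crux's «`3² ∣`» disjunct is the top of the torsion scale: no `ℤ/27` row
  exists); (d) `ord₃ #W'(ℚ)_tors = 2` exactly, and a globally minimal model `W₉` of `W'` has **`c₃(W₉) = 3`, Kodaira
  type `IV` or `IV*` at `3`, and is itself an O6 row** (`exists_minimalModel_of_nineTorsionMember`);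
  `nineTorsionMember_structure_of_classO6` packages (a)–(d) under `ClassO6 W 3`.
* §2 **the stub reduced to its `ℤ/9` curves.** `Sig.stub_red_nineTorsionMember` (verbatim) IMPLIES, with no input,
  the upper half `MissingUpperBoundAt V 3` for every globally minimal `V` additive at `3` with `r_an(V) = 0` and a
  rational point of order `9` (`nineTorsionCurves_of_stub_red_nineTorsionMember`: such a `V` is an O6 row, `E[3]`
  reducible by its rational `3`-torsion, and its own `ℤ/9` member); CONVERSELY, granted Cassels' isogeny invariance
  (`bsdRHS_eq_of_isIsogenous`), GZK (`rank_eq_analyticRank_of_analyticRank_le_one`) and modularity of `L(E,s)`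
  (`hasEntireLFunction_rat`) — three of the six held children of the item's split (19708, 19709, 19710) — that
  statement about `ℤ/9` CURVES gives the stub back (`stub_red_nineTorsionMember_of_nineTorsionCurves`: the upper half
  transports from the `ℤ/9` member to `W`, b2b `TwistComparison.missingUpperBoundAt_of_isIsogenous`; `r_an` is a class
  invariant, `analyticRank_eq_of_isIsogenous'`). So, modulo those three printed theorems,
  **`stub_red_nineTorsionMember` ⟺ the Euler-system half of BSD at `3` for the analytic-rank-`0` fibres of `X₁(9)`
  that are additive at `3`** (`stub_red_nineTorsionMember_iff_nineTorsionCurves`) — a one-parameter family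
  (Kubert's `E_{C₉}(t)`; additive at `3` iff `3 ∣ a + b` for `t = a/b`, Barrios–Roy), each member wild of type `IV`/`IV*`
  with `c₃ = 3`, semistable elsewhere; the reducibility hypothesis of the stub is automatic on it.

HONEST RESIDUE. Nothing here bounds `Ш`: on that family the upper half is still Kato's bound at Kato's member read
sharply (count fact 19707) — the census members 54b3, 1890r3, 122094bl3 have `Ш[3] = 0` by two descent engines
(j263658), evidence only. No item is closed; the trust base of 19190 is unchanged.

References: [SilvermanAEC2009] VII.3.1, VII.6.1, Cor. VII.7.2, VIII.8.3; [SilvermanATAEC1994] Cor. IV.9.2, Table 4.1;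
[Cassels1965ArithmeticVIII]; [Miller2011LMS] Def. 1.1; [BarriosRoy2022LocalData] Thm. 3.8 (table, `T = C₉`);
[Lorenzini2011TorsionTamagawa] Prop. 1.1 (d).
-/

set_option autoImplicit false
-- the Theorems directory repeats the summit name (sibling precedent `KatoDescentPotSupersingularAssembly.lean`)
set_option linter.dupNamespace false

noncomputable section

open scoped Classical

namespace Summit.BirchSwinnertonDyer.BirchSwinnertonDyer.Theorems.WildUpperReducibleNineTorsionStructure

open WeierstrassCurve IsDedekindDomain Literature.NumberTheory.EllipticCurves
  Literature.NumberTheory.DiophantineGeometry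
  Literature.NumberTheory.EllipticCurves.Rank1Residual
  Literature.NumberTheory.EllipticCurves.Rank1Residual.Typed
  Summit.BirchSwinnertonDyer.Rank1Residual
  Summit.BirchSwinnertonDyer.Rank1Residual.Additive
  Summit.BirchSwinnertonDyer.BirchSwinnertonDyer.Theorems.WildUpperReducibleNineTorsionLocal

/-! ## §1 The scope of `stub_red_nineTorsionMember`, read on the `ℚ`-isogeny class -/

section NineTorsionClass

variable {W W' : WeierstrassCurve ℚ} [W.IsElliptic] [W'.IsElliptic]

omit [W.IsElliptic] in
/-- **The stub's hypothesis «a member with `3² ∣ #tors`» says: the class contains a curve with a rational point of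
ORDER `9`** (a fibre of `X₁(9)`), Mazur-free (`exists_addOrderOf_eq_nine_of_dvd_torsionOrder`; conversely
`addOrderOf_dvd_torsionOrder`). [cite: CremonaAlgorithms1997, §3.3 p. 52] -/
theorem nineTorsionMember_iff_exists_addOrderOf_eq_nine :
    (∃ (W' : WeierstrassCurve ℚ) (_ : W'.IsElliptic), IsIsogenous W W' ∧ 3 ^ 2 ∣ W'.torsionOrder) ↔
      ∃ (W' : WeierstrassCurve ℚ) (_ : W'.IsElliptic), IsIsogenous W W' ∧
        ∃ P : W'.toAffine.Point, addOrderOf P = 9 := by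
  constructor
  · rintro ⟨W', hE', hiso, h9⟩
    exact ⟨W', hE', hiso, exists_addOrderOf_eq_nine_of_dvd_torsionOrder W' h9⟩
  · rintro ⟨W', hE', hiso, P, hP⟩
    refine ⟨W', hE', hiso, ?_⟩
    have hfin : IsOfFinAddOrder P := addOrderOf_pos_iff.mp (by rw [hP]; norm_num)
    have h := addOrderOf_dvd_torsionOrder W' hfin
    rw [hP] at h
    simpa using h

/-- **Semistable away from `3`: if some `W' ∼ W` has `9 ∣ #W'(ℚ)_tors`, then `W` is NOT additive at any prime
`ℓ ≠ 3`.** Pass to a globally minimal model `C • W'` (*AEC* VIII.8.3; same torsion), which has a rational point of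
order `9` and hence is not additive at `ℓ` (`not_addv_of_addOrderOf_eq_nine`: `9 ∣ c_ℓ ≤ 4` is absurd); additive
reduction is a `ℚ`-isogeny invariant (`X2.addv_iff_of_isIsogenous`). Unconditional.
[cite: SilvermanAEC2009, VII.3 Prop. 3.1, Thm. VII.6.1, Cor. VII.7.2, VIII.8 Cor. 8.3] -/
theorem not_addv_of_isIsogenous_of_nine_dvd_torsionOrder (hiso : IsIsogenous W W')
    (h9 : 3 ^ 2 ∣ W'.torsionOrder) {ℓ : ℕ} [Fact ℓ.Prime] (hℓ3 : ℓ ≠ 3) : ¬ Addv W ℓ := by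
  obtain ⟨C, hC⟩ := hasGlobalMinimalModel_rat_holds W'
  haveI := hC
  have hiso' : IsIsogenous W (C • W') := hiso.smul_right C
  have h9' : 3 ^ 2 ∣ (C • W').torsionOrder := by rwa [torsionOrder_variableChange_holds W' C]
  intro hadd
  exact not_addv_of_nine_dvd_torsionOrder (C • W') h9' hℓ3 ((X2.addv_iff_of_isIsogenous hiso').mp hadd)

/-- The same from the stub's hypothesis as displayed (`∃ W' …`): a row of `stub_red_nineTorsionMember` is semistable
at every `ℓ ≠ 3`. [cite: SilvermanAEC2009, VII.3 Prop. 3.1, Thm. VII.6.1, Cor. VII.7.2] -/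
theorem not_addv_of_nineTorsionMember
    (h : ∃ (W' : WeierstrassCurve ℚ) (_ : W'.IsElliptic), IsIsogenous W W' ∧ 3 ^ 2 ∣ W'.torsionOrder)
    {ℓ : ℕ} [Fact ℓ.Prime] (hℓ3 : ℓ ≠ 3) : ¬ Addv W ℓ := by
  obtain ⟨W', hE', hiso, h9⟩ := h
  exact not_addv_of_isIsogenous_of_nine_dvd_torsionOrder hiso h9 hℓ3

variable [Fact (Nat.Prime 3)]

/-- **No `ℤ/27` anywhere in the class of a row additive at `3`**: `W` additive at `3`, `W ∼ W'` ⟹ `27 ∤ #W'(ℚ)_tors`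
(every member is additive at `3`; `not_pow_three_dvd_torsionOrder_of_addv_three` on a globally minimal model).
Unconditional — the crux's torsion disjunct «`3² ∣ #tors` of a member» is the maximum. [cite: SilvermanAEC2009, VII.3 Prop. 3.1, Thm. VII.6.1, Cor. VII.7.2] -/
theorem not_pow_three_dvd_torsionOrder_of_isIsogenous_of_addv_three (hadd : Addv W 3)
    (hiso : IsIsogenous W W') : ¬ 3 ^ 3 ∣ W'.torsionOrder := by
  obtain ⟨C, hC⟩ := hasGlobalMinimalModel_rat_holds W'
  haveI := hC
  have hiso' : IsIsogenous W (C • W') := hiso.smul_right C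
  have h := not_pow_three_dvd_torsionOrder_of_addv_three (C • W')
    ((X2.addv_iff_of_isIsogenous hiso').mp hadd)
  rwa [torsionOrder_variableChange_holds W' C] at h

/-- `W` additive at `3`, `W ∼ W'` ⟹ `ord₃ #W'(ℚ)_tors ≤ 2` (Mazur-free `t ≤ 2` on the whole class).
[cite: SilvermanAEC2009, VII.3 Prop. 3.1, Thm. VII.6.1, Cor. VII.7.2] -/
theorem padicValNat_three_torsionOrder_le_two_of_isIsogenous_of_addv_three (hadd : Addv W 3)
    (hiso : IsIsogenous W W') : padicValNat 3 W'.torsionOrder ≤ 2 := by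
  have hpos : W'.torsionOrder ≠ 0 := (W'.torsionOrder_pos_holds).ne'
  by_contra hlt
  exact not_pow_three_dvd_torsionOrder_of_isIsogenous_of_addv_three hadd hiso
    ((padicValNat_dvd_iff_le hpos).mpr (by omega))

/-- `W` additive at `3`, `W ∼ W'` ⟹ `#W'(ℚ)_tors ≤ 12`. [cite: SilvermanAEC2009, VII.3 Prop. 3.1, Thm. VII.6.1, Cor. VII.7.2] -/
theorem torsionOrder_le_twelve_of_isIsogenous_of_addv_three (hadd : Addv W 3)
    (hiso : IsIsogenous W W') : W'.torsionOrder ≤ 12 := by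
  obtain ⟨C, hC⟩ := hasGlobalMinimalModel_rat_holds W'
  haveI := hC
  have hiso' : IsIsogenous W (C • W') := hiso.smul_right C
  have h := torsionOrder_le_twelve_of_addv_three (C • W') ((X2.addv_iff_of_isIsogenous hiso').mp hadd)
  rwa [torsionOrder_variableChange_holds W' C] at h

/-- On a row of the stub the `ℤ/9` member has `ord₃ #W'(ℚ)_tors = 2` exactly. [cite: SilvermanAEC2009, VII.3 Prop. 3.1 and Thm. VII.6.1] -/
theorem padicValNat_three_torsionOrder_eq_two_of_isIsogenous_of_addv_three (hadd : Addv W 3)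
    (hiso : IsIsogenous W W') (h9 : 3 ^ 2 ∣ W'.torsionOrder) : padicValNat 3 W'.torsionOrder = 2 := by
  have hpos : W'.torsionOrder ≠ 0 := (W'.torsionOrder_pos_holds).ne'
  have hge : 2 ≤ padicValNat 3 W'.torsionOrder := (padicValNat_dvd_iff_le hpos).mp h9
  have hle := padicValNat_three_torsionOrder_le_two_of_isIsogenous_of_addv_three hadd hiso
  omega

/-- **The `ℤ/9` member, when globally minimal, has `c₃ = 3`** (`W` additive at `3`, `W ∼ W'`, `9 ∣ #W'(ℚ)_tors`).
[cite: SilvermanAEC2009, VII.3 Prop. 3.1 and Thm. VII.6.1] [cite: BarriosRoy2022LocalData, Thm. 3.8 (table, T = C₉)] -/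
theorem localTamagawaNumber_eq_three_of_isIsogenous_of_nine_dvd_torsionOrder [W'.IsGloballyMinimal]
    (hadd : Addv W 3) (hiso : IsIsogenous W W') (h9 : 3 ^ 2 ∣ W'.torsionOrder) :
    (W'.baseChange ℚ_[3]).localTamagawaNumber ℤ_[3] = 3 :=
  localTamagawaNumber_eq_three_of_nine_dvd_torsionOrder_of_addv_three W'
    ((X2.addv_iff_of_isIsogenous hiso).mp hadd) h9

/-- **A globally minimal model `W₉ = C • W'` of the `ℤ/9` member: `c₃(W₉) = 3`, Kodaira type `IV` or `IV*` at `3`, and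
`W₉` is itself an O6 row** (`W` additive at `3`, `W ∼ W'`, `9 ∣ #W'(ℚ)_tors`). Unconditional.
[cite: SilvermanAEC2009, VII.3 Prop. 3.1, Thm. VII.6.1, VIII.8 Cor. 8.3] [cite: SilvermanATAEC1994, Cor. IV.9.2 and Table 4.1]
[cite: BarriosRoy2022LocalData, Thm. 3.8 (table, T = C₉: type IV, f₃ = 3, c₃ = 3)] -/
theorem exists_minimalModel_of_nineTorsionMember (hadd : Addv W 3) (hiso : IsIsogenous W W')
    (h9 : 3 ^ 2 ∣ W'.torsionOrder) :
    ∃ C : VariableChange ℚ, (C • W').IsGloballyMinimal ∧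
      ((C • W').baseChange ℚ_[3]).localTamagawaNumber ℤ_[3] = 3 ∧
      ((C • W').kodairaSymbolAt (placeOf 3) = .IV ∨ (C • W').kodairaSymbolAt (placeOf 3) = .IVstar) ∧
      ClassO6 (C • W') 3 := by
  obtain ⟨C, hC⟩ := hasGlobalMinimalModel_rat_holds W'
  haveI := hC
  have hiso' : IsIsogenous W (C • W') := hiso.smul_right C
  have hadd' : Addv (C • W') 3 := (X2.addv_iff_of_isIsogenous hiso').mp hadd
  have h9' : 3 ^ 2 ∣ (C • W').torsionOrder := by rwa [torsionOrder_variableChange_holds W' C]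
  exact ⟨C, hC, localTamagawaNumber_eq_three_of_nine_dvd_torsionOrder_of_addv_three (C • W') hadd' h9',
    kodairaSymbolAt_three_eq_IV_or_IVstar_of_nine_dvd_torsionOrder (C • W') hadd' h9',
    classO6_three_of_nine_dvd_torsionOrder (C • W') hadd' h9'⟩

/-- **The scope of `stub_red_nineTorsionMember`, structurally (package).** On an O6 row `W` with a member `W'`,
`9 ∣ #W'(ℚ)_tors`: (a) `W'` has a rational point of order `9`; (b) `ord₃ #W'(ℚ)_tors = 2`; (c) `W` is semistable at
every `ℓ ≠ 3`; (d) no member has `27 ∣ #tors`; (e) a globally minimal model of `W'` has `c₃ = 3`, Kodaira `IV`/`IV*`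
at `3`, and is an O6 row. UNCONDITIONAL; nothing about `Ш`. [cite: SilvermanAEC2009, VII.3 Prop. 3.1, Thm. VII.6.1, Cor. VII.7.2]
[cite: SilvermanATAEC1994, Cor. IV.9.2 and Table 4.1] -/
theorem nineTorsionMember_structure_of_classO6 [W.IsGloballyMinimal] (hO : ClassO6 W 3)
    (hiso : IsIsogenous W W') (h9 : 3 ^ 2 ∣ W'.torsionOrder) :
    (∃ P : W'.toAffine.Point, addOrderOf P = 9) ∧
      padicValNat 3 W'.torsionOrder = 2 ∧
      (∀ (ℓ : ℕ) [Fact ℓ.Prime], ℓ ≠ 3 → ¬ Addv W ℓ) ∧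
      (∀ (W'' : WeierstrassCurve ℚ) [W''.IsElliptic], IsIsogenous W W'' → ¬ 3 ^ 3 ∣ W''.torsionOrder) ∧
      ∃ C : VariableChange ℚ, (C • W').IsGloballyMinimal ∧
        ((C • W').baseChange ℚ_[3]).localTamagawaNumber ℤ_[3] = 3 ∧
        ((C • W').kodairaSymbolAt (placeOf 3) = .IV ∨ (C • W').kodairaSymbolAt (placeOf 3) = .IVstar) ∧
        ClassO6 (C • W') 3 :=
  ⟨exists_addOrderOf_eq_nine_of_dvd_torsionOrder W' h9,
    padicValNat_three_torsionOrder_eq_two_of_isIsogenous_of_addv_three hO.2.1 hiso h9,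
    fun _ _ hℓ3 ↦ not_addv_of_isIsogenous_of_nine_dvd_torsionOrder hiso h9 hℓ3,
    fun _ _ hiso'' ↦ not_pow_three_dvd_torsionOrder_of_isIsogenous_of_addv_three hO.2.1 hiso'',
    exists_minimalModel_of_nineTorsionMember hO.2.1 hiso h9⟩

end NineTorsionClass

/-! ## §2 The registered stub REDUCED TO ITS `ℤ/9` CURVES (and back, modulo Cassels, GZK, modularity) -/

section Reduction

/-- **`Sig.stub_red_nineTorsionMember` (verbatim, hypothesis `hstub`) ⟹ the upper half at `3` for every globally
minimal curve additive at `3`, of analytic rank `0`, with a rational point of order `9`** — no input: such a `V` is an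
O6 row (`classO6_three_of_nine_dvd_torsionOrder`), `E[3]` is reducible by the rational `3`-torsion
(`not_hasIrreducibleModPGaloisRep_of_dvd_torsionOrder`), and `V` is its own `ℤ/9` member (`IsIsogenous.refl_holds`).
[cite: SilvermanATAEC1994, IV.10.4 and Table 4.1] [cite: Mazur1977, Ch. III §5, p. 157] -/
theorem nineTorsionCurves_of_stub_red_nineTorsionMember
    (hstub : ∀ (W : WeierstrassCurve ℚ) [W.IsElliptic] [W.IsGloballyMinimal] [Fact (3 : ℕ).Prime],
      W.analyticRank = 0 → ClassO6 W 3 → ¬ W.HasIrreducibleModPGaloisRep 3 →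
      (∃ (W' : WeierstrassCurve ℚ) (_ : W'.IsElliptic), IsIsogenous W W' ∧ 3 ^ 2 ∣ W'.torsionOrder) →
        MissingUpperBoundAt W 3) :
    ∀ (V : WeierstrassCurve ℚ) [V.IsElliptic] [V.IsGloballyMinimal] [Fact (3 : ℕ).Prime],
      V.analyticRank = 0 → Addv V 3 → (∃ P : V.toAffine.Point, addOrderOf P = 9) →
        MissingUpperBoundAt V 3 := by
  intro V _ _ _ hr hadd hP
  obtain ⟨P, hP⟩ := hP
  have hfin : IsOfFinAddOrder P := addOrderOf_pos_iff.mp (by rw [hP]; norm_num)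
  have h9 : 3 ^ 2 ∣ V.torsionOrder := by
    have h := addOrderOf_dvd_torsionOrder V hfin
    rw [hP] at h
    simpa using h
  have h3 : 3 ∣ V.torsionOrder := (dvd_pow_self 3 two_ne_zero).trans h9
  exact hstub V hr (classO6_three_of_nine_dvd_torsionOrder V hadd h9)
    (not_hasIrreducibleModPGaloisRep_of_dvd_torsionOrder V 3 h3) ⟨V, ‹_›, IsIsogenous.refl_holds V, h9⟩

/-- **Conversely: the upper half at `3` on the `ℤ/9` CURVES (globally minimal, additive at `3`, `r_an = 0`, a rational
point of order `9`) ⟹ `Sig.stub_red_nineTorsionMember` (verbatim)**, granted Cassels' isogeny invariance of the BSD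
quotient, GZK (`rank = r_an ≤ 1`, `Ш` finite) and modularity of `L(E,s)` — three held children of the item's split
(19708/19709/19710). Proof: a globally minimal model `W₉` of the `ℤ/9` member is additive at `3` with a point of order
`9` and `r_an(W₉) = r_an(W) = 0` (`analyticRank_eq_of_isIsogenous'`); the upper half at `W₉` transports to `W`
(b2b `TwistComparison.missingUpperBoundAt_of_isIsogenous`). The stub's reducibility hypothesis is not used. CONDITIONAL
on the three named facts. [cite: Cassels1965ArithmeticVIII] [cite: Miller2011LMS, §1 and Def. 1.1]
[cite: SilvermanAEC2009, Cor. VII.7.2, VIII.8 Cor. 8.3] -/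
theorem stub_red_nineTorsionMember_of_nineTorsionCurves (hCassels : bsdRHS_eq_of_isIsogenous)
    (hGZK : rank_eq_analyticRank_of_analyticRank_le_one) (hmod : hasEntireLFunction_rat)
    (hnine : ∀ (V : WeierstrassCurve ℚ) [V.IsElliptic] [V.IsGloballyMinimal] [Fact (3 : ℕ).Prime],
      V.analyticRank = 0 → Addv V 3 → (∃ P : V.toAffine.Point, addOrderOf P = 9) →
        MissingUpperBoundAt V 3) :
    ∀ (W : WeierstrassCurve ℚ) [W.IsElliptic] [W.IsGloballyMinimal] [Fact (3 : ℕ).Prime],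
      W.analyticRank = 0 → ClassO6 W 3 → ¬ W.HasIrreducibleModPGaloisRep 3 →
      (∃ (W' : WeierstrassCurve ℚ) (_ : W'.IsElliptic), IsIsogenous W W' ∧ 3 ^ 2 ∣ W'.torsionOrder) →
        MissingUpperBoundAt W 3 := by
  intro W _ _ _ hr hO _ h
  obtain ⟨W', hE', hiso, h9⟩ := h
  obtain ⟨C, hC⟩ := hasGlobalMinimalModel_rat_holds W'
  haveI := hC
  have hiso' : IsIsogenous W (C • W') := hiso.smul_right C
  have h9' : 3 ^ 2 ∣ (C • W').torsionOrder := by rwa [torsionOrder_variableChange_holds W' C]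
  have hadd' : Addv (C • W') 3 := (X2.addv_iff_of_isIsogenous hiso').mp hO.2.1
  have hr' : (C • W').analyticRank = 0 := (analyticRank_eq_of_isIsogenous' hiso').symm.trans hr
  have hup : MissingUpperBoundAt (C • W') 3 :=
    hnine (C • W') hr' hadd' (exists_addOrderOf_eq_nine_of_dvd_torsionOrder (C • W') h9')
  exact TwistComparison.missingUpperBoundAt_of_isIsogenous (C • W') W 3 hCassels hGZK hmod
    hiso'.symm_of_charZero (by rw [hr']; exact zero_le_one) hup

/-- **`stub_red_nineTorsionMember` ⟺ the upper half at `3` on the analytic-rank-`0` `ℤ/9` curves additive at `3`**,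
granted Cassels / GZK / modularity (→ needs nothing; ← needs the three facts). The registered stub is thereby a
statement about ONE explicit family (the fibres of `X₁(9)` wild at `3`: Kubert's `E_{C₉}`, additive iff `3 ∣ a+b`,
then type `IV`, `c₃ = 3`, semistable elsewhere). CONDITIONAL on the three named facts (← only).
[cite: Cassels1965ArithmeticVIII] [cite: Miller2011LMS, §1 and Def. 1.1] [cite: BarriosRoy2022LocalData, Thm. 3.8 (table, T = C₉)] -/
theorem stub_red_nineTorsionMember_iff_nineTorsionCurves (hCassels : bsdRHS_eq_of_isIsogenous)
    (hGZK : rank_eq_analyticRank_of_analyticRank_le_one) (hmod : hasEntireLFunction_rat) :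
    (∀ (W : WeierstrassCurve ℚ) [W.IsElliptic] [W.IsGloballyMinimal] [Fact (3 : ℕ).Prime],
      W.analyticRank = 0 → ClassO6 W 3 → ¬ W.HasIrreducibleModPGaloisRep 3 →
      (∃ (W' : WeierstrassCurve ℚ) (_ : W'.IsElliptic), IsIsogenous W W' ∧ 3 ^ 2 ∣ W'.torsionOrder) →
        MissingUpperBoundAt W 3) ↔
    ∀ (V : WeierstrassCurve ℚ) [V.IsElliptic] [V.IsGloballyMinimal] [Fact (3 : ℕ).Prime],
      V.analyticRank = 0 → Addv V 3 → (∃ P : V.toAffine.Point, addOrderOf P = 9) →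
        MissingUpperBoundAt V 3 :=
  ⟨fun h ↦ nineTorsionCurves_of_stub_red_nineTorsionMember h,
    fun h ↦ stub_red_nineTorsionMember_of_nineTorsionCurves hCassels hGZK hmod h⟩

end Reduction

end Summit.BirchSwinnertonDyer.BirchSwinnertonDyer.Theorems.WildUpperReducibleNineTorsionStructure

end
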